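import Summits.CriticalPhenomena.PercolationContinuityZ3.Theorems.SahiGridPatternOrderN
import Summits.CriticalPhenomena.PercolationContinuityZ3.Theorems.PercNearOneGluingNoHeavyLowerTailSahiGridPatternKernel

/-!
# The order-`n` pattern functional at `n = 3` IS the pattern functional `sStarD`: `PatternPosN 3 d ↔ PatternPos d`

Support file (Sahi cell `prim-sahi`, seat `prim-sahi-typer`, generation 26; `--supports stmt-CriticalPhenomena-4575`).  Pure
proofs, no definitions, no `sorry`, standard axioms.

`SahiGridPatternN.sStarN n d` (the recursive `n`-copy kernel `SahiCopyKernel.copyKernel n` summed over the permutation patterns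
of `[n]^d`) specialises at `n = 3` to `SahiGridPattern.sStarD` of seat `prim-sahi-p1` (generation 7):
`sStarN 3 d F = sStarD (F 0) (F 1) (F 2)` (`sStarN_three_eq_sStarD`).  The two three-copy kernels are NOT equal pointwise —
the recursion evaluates the "all three together" term at the last copy, `hZ` at the first — but each of the five monomial
shapes (`2·[ABC]`, `−[A][BC]`, `−[B][AC]`, `−[C][AB]`, `+[A][B][C]`) has the same coefficient, and the sum over all patterns of a
monomial depends only on its shape (re-index the patterns by a fixed permutation of the copies on every axis,
`sum_pattern_reindex`).  Consequently `PatternPosN 3 d ↔ PatternPos d` (`patternPosN_three_iff`), and the settled dimensions of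
the order-3 programme transfer: **`PatternPosN 3 d` for `d ≤ 3`, kernel-only** (`patternPosN_three_of_le_three`, from
`SahiGridPattern.sStarD_three_nonneg` + `patternPos_of_le`). [this work]
-/

namespace Summit.CriticalPhenomena.PercolationContinuityZ3.Theorems.SahiGridPatternN

open Finset Literature.Probability.LatticeModels
open SahiCopyKernel (copyKernel incMatrix mtail copyKernel_succ_succ copyKernel_one)
open SahiGridPattern (sStarD PatternPos patternPos_of_le sStarD_three_nonneg)
open SahiGrid3 (ind hZ)
open scoped BigOperators

variable {d : ℕ}

/-- `K_2(M) = M₁₁·M₀₁ − M₁₁·M₀₀` (the covariance kernel: slot `1` at copy `1`, slot `0` at copy `1` resp. `0`). [this work] -/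
theorem copyKernel_two {R : Type*} [CommRing R] (M : Fin 2 → Fin 2 → R) :
    copyKernel 2 M = M 1 1 * M 0 1 - M 1 1 * M 0 0 := by
  rw [copyKernel_succ_succ]
  simp [copyKernel_one, mtail, Function.update]

/-- `K_3(M) = 2·M₀₂M₁₂M₂₂ − M₀₁M₁₁M₂₂ − M₀₂M₁₁M₂₂ − M₀₀M₁₂M₂₂ + M₀₀M₁₁M₂₂` — Sahi's `E₃` shape coefficients `2, −1, −1, −1, +1`
with the copies assigned by the recursion. [this work] -/
theorem copyKernel_three {R : Type*} [CommRing R] (M : Fin 3 → Fin 3 → R) :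
    copyKernel 3 M = 2 * (M 0 2 * M 1 2 * M 2 2) - M 0 1 * M 1 1 * M 2 2 - M 0 2 * M 1 1 * M 2 2
      - M 0 0 * M 1 2 * M 2 2 + M 0 0 * M 1 1 * M 2 2 := by
  rw [copyKernel_succ_succ, Fin.sum_univ_two, copyKernel_two, copyKernel_two, copyKernel_two]
  simp only [mtail, Function.update_self, Function.update_of_ne (show (1 : Fin 2) ≠ 0 by decide),
    Function.update_of_ne (show (0 : Fin 2) ≠ 1 by decide), Fin.succ_zero_eq_one, Fin.succ_one_eq_two]
  ring

/-- Re-indexing the permutation patterns by a fixed permutation `σ` of the copies on every axis: the pattern sum of any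
function of the `n` pattern points is unchanged when the points are relabelled by `σ`. [this work] -/
theorem sum_pattern_reindex {n : ℕ} (σ : Equiv.Perm (Fin n)) (G : (Fin n → Pn n d) → ℤ) :
    ∑ π : Fin d → Equiv.Perm (Fin n), G (col π) = ∑ π : Fin d → Equiv.Perm (Fin n), G (fun c => col π (σ c)) := by
  have h : ∀ π : Fin d → Equiv.Perm (Fin n), (fun c => col π (σ c)) = col (fun a => π a * σ) := by
    intro π; funext c a; rfl
  simp_rw [h]
  exact (Fintype.sum_equiv (Equiv.piCongrRight fun _ => Equiv.mulRight σ) (fun π => G (col fun a => π a * σ))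
    (fun π => G (col π)) fun π => rfl).symm

/-- The incidence matrix at a pattern, entrywise, is the integer indicator of `SahiGrid3`. [this work] -/
theorem incMatrix_apply_eq_ind {n : ℕ} (F : Fin n → Finset (Pn n d)) (p : Fin n → Pn n d) (i c : Fin n) :
    incMatrix F p i c = ind (F i) (p c) := rfl

/-- **`sStarN 3 d F = sStarD (F 0) (F 1) (F 2)`**: the order-3 instance of the order-`n` pattern functional is the pattern
functional of the order-3 programme. [this work] -/
theorem sStarN_three_eq_sStarD (F : Fin 3 → Finset (Pn 3 d)) : sStarN 3 d F = sStarD (F 0) (F 1) (F 2) := by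
  -- the five shape sums, each a function of the three pattern points
  set I0 := ind (F 0) with hI0
  set I1 := ind (F 1) with hI1
  set I2 := ind (F 2) with hI2
  have hN : sStarN 3 d F = ∑ π : Fin d → Equiv.Perm (Fin 3),
      (2 * (I0 (col π 2) * I1 (col π 2) * I2 (col π 2)) - I0 (col π 1) * I1 (col π 1) * I2 (col π 2)
        - I0 (col π 2) * I1 (col π 1) * I2 (col π 2) - I0 (col π 0) * I1 (col π 2) * I2 (col π 2)
        + I0 (col π 0) * I1 (col π 1) * I2 (col π 2)) := by
    unfold sStarN
    refine Finset.sum_congr rfl fun π _ => ?_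
    rw [copyKernel_three]
    rfl
  have hD : sStarD (F 0) (F 1) (F 2) = ∑ π : Fin d → Equiv.Perm (Fin 3),
      (2 * (I0 (col π 0) * I1 (col π 0) * I2 (col π 0)) - I0 (col π 0) * I1 (col π 1) * I2 (col π 1)
        - I1 (col π 0) * I0 (col π 1) * I2 (col π 1) - I2 (col π 0) * I0 (col π 1) * I1 (col π 1)
        + I0 (col π 0) * I1 (col π 1) * I2 (col π 2)) := by
    unfold sStarD hZ
    rfl
  rw [hN, hD]
  simp only [Finset.sum_add_distrib, Finset.sum_sub_distrib]
  -- shape [ABC]: copy 2 ↦ copy 0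
  have e1 : ∑ π : Fin d → Equiv.Perm (Fin 3), 2 * (I0 (col π 2) * I1 (col π 2) * I2 (col π 2)) =
      ∑ π : Fin d → Equiv.Perm (Fin 3), 2 * (I0 (col π 0) * I1 (col π 0) * I2 (col π 0)) := by
    rw [sum_pattern_reindex (Equiv.swap 0 2) fun p => 2 * (I0 (p 0) * I1 (p 0) * I2 (p 0))]
    rfl
  -- shape [AB][C]: (AB at 1, C at 2) ↦ (AB at 1, C at 0)
  have e2 : ∑ π : Fin d → Equiv.Perm (Fin 3), I0 (col π 1) * I1 (col π 1) * I2 (col π 2) =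
      ∑ π : Fin d → Equiv.Perm (Fin 3), I2 (col π 0) * I0 (col π 1) * I1 (col π 1) := by
    rw [sum_pattern_reindex (Equiv.swap 0 2) fun p => I2 (p 0) * I0 (p 1) * I1 (p 1)]
    refine Finset.sum_congr rfl fun π _ => ?_
    show _ = I2 (col π ((Equiv.swap (0 : Fin 3) 2) 0)) * I0 (col π ((Equiv.swap (0 : Fin 3) 2) 1)) *
      I1 (col π ((Equiv.swap (0 : Fin 3) 2) 1))
    rw [Equiv.swap_apply_left, Equiv.swap_apply_of_ne_of_ne (by decide) (by decide)]
    ring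
  -- shape [AC][B]: (AC at 2, B at 1) ↦ (AC at 1, B at 0): σ = (0 1 2) ↦ σ 0 = 1, σ 1 = 2
  have e3 : ∑ π : Fin d → Equiv.Perm (Fin 3), I0 (col π 2) * I1 (col π 1) * I2 (col π 2) =
      ∑ π : Fin d → Equiv.Perm (Fin 3), I1 (col π 0) * I0 (col π 1) * I2 (col π 1) := by
    rw [sum_pattern_reindex ((Equiv.swap 1 2).trans (Equiv.swap 0 1)) fun p => I1 (p 0) * I0 (p 1) * I2 (p 1)]
    refine Finset.sum_congr rfl fun π _ => ?_
    have h0 : ((Equiv.swap (1 : Fin 3) 2).trans (Equiv.swap 0 1)) 0 = 1 := by decide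
    have h1 : ((Equiv.swap (1 : Fin 3) 2).trans (Equiv.swap 0 1)) 1 = 2 := by decide
    show _ = I1 (col π (((Equiv.swap (1 : Fin 3) 2).trans (Equiv.swap 0 1)) 0)) *
      I0 (col π (((Equiv.swap (1 : Fin 3) 2).trans (Equiv.swap 0 1)) 1)) *
      I2 (col π (((Equiv.swap (1 : Fin 3) 2).trans (Equiv.swap 0 1)) 1))
    rw [h0, h1]
    ring
  -- shape [BC][A]: (BC at 2, A at 0) ↦ (BC at 1, A at 0)
  have e4 : ∑ π : Fin d → Equiv.Perm (Fin 3), I0 (col π 0) * I1 (col π 2) * I2 (col π 2) =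
      ∑ π : Fin d → Equiv.Perm (Fin 3), I0 (col π 0) * I1 (col π 1) * I2 (col π 1) := by
    rw [sum_pattern_reindex (Equiv.swap 1 2) fun p => I0 (p 0) * I1 (p 1) * I2 (p 1)]
    refine Finset.sum_congr rfl fun π _ => ?_
    show _ = I0 (col π ((Equiv.swap (1 : Fin 3) 2) 0)) * I1 (col π ((Equiv.swap (1 : Fin 3) 2) 1)) *
      I2 (col π ((Equiv.swap (1 : Fin 3) 2) 1))
    rw [Equiv.swap_apply_left, Equiv.swap_apply_of_ne_of_ne (by decide) (by decide)]
  rw [e1, e2, e3, e4]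
  ring

/-- **`PatternPosN 3 d ↔ PatternPos d`.** [this work] -/
theorem patternPosN_three_iff : PatternPosN 3 d ↔ PatternPos d := by
  constructor
  · intro h A B C hA hB hC
    have h' := h ![A, B, C] fun i => by fin_cases i <;> assumption
    rwa [sStarN_three_eq_sStarD] at h'
  · intro h F hF
    rw [sStarN_three_eq_sStarD]
    exact h _ _ _ (hF 0) (hF 1) (hF 2)

/-- **`PatternPosN 3 d` for `d ≤ 3`, KERNEL-ONLY** (the settled cells `(d,3)`, `d ≤ 3`, of the order-3 programme, transferred:
`SahiGridPattern.sStarD_three_nonneg` is the `[3]³` inequality by 226 bilinear slice certificates checked by `decide`).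
[this work] -/
theorem patternPosN_three_of_le_three (hd : d ≤ 3) : PatternPosN 3 d :=
  patternPosN_three_iff.2 (patternPos_of_le hd fun A B C => sStarD_three_nonneg A B C)

end Summit.CriticalPhenomena.PercolationContinuityZ3.Theorems.SahiGridPatternN
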